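/-
Copyright (c) 2026 the pub-hodgecm-mathlib formalisation cell (harness21).  Prover seat hodgecm-mathlib-K2E3-p03 (g11), Track B «K2-LIT»,
hLiu418 = `stmt-HodgeConjecture-24832`; K1a (C-K) desk K2E4-p10 (g11), LEAD F0P6-plan (g16) BATCH #297 (3) ∕ #299 (3): (C-K-3)(L) FILE A3 —
THE WEIGHTED ξ-INTEGRAND `G = W·Φ·D`: ITS LINE DERIVATIVES, ONE COORDINATE INTEGRATION BY PARTS `∫ ℓ·D_v G = −∫ G`, AND THE POINTWISE EULER
IDENTITY `Σ x_i D_i G = −2πi t·WΦ + (gained terms)`.  THEOREMS ONLY (no `def`, no `instance`, no notation, no named-fact hypothesis, no `sorry`);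
lane `--supports stmt-HodgeConjecture-24832 --as helper`.
-/
import Summits.HodgeConjecture.HodgeConjecture.Theorems.K2LiuHermTwoXiGainKernel        -- ★ p865549 FILE A1 (this seat): (E1), `integrable_of_norm_le_gain`
import Summits.HodgeConjecture.HodgeConjecture.Theorems.K2LiuHermTwoXiEulerCalculus      -- ★ p865550 FILE A2 (this seat): radial field, homogeneity, divisor, `hasLineDerivAt_xiTwoIntegrand`
import HarnessLib

/-!
# Crux `HLiu418`, K1-a♮ (C-K-3)(L) FILE A3: integration by parts of the weighted ξ-integrand and the POINTWISE EULER IDENTITY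

Cell `hodgecm-mathlib`, crux item hLiu418 = `stmt-HodgeConjecture-24832` (helper lane `--supports … --as helper`, count-neutral), route of record
`HCCMUnconditional`; squad K2 ∕ K2Liu.  Third of four files proving the CROSSING LEMMA «the twisted big-cell block of a flat `K_w`-finite Siegel
section is holomorphic across `re s = ½`» (census `K2/K2E3-p03/g11/CENSUS-CK3-L-crossing.md`; A1 ★ `K2LiuHermTwoXiGainKernel`, A2 ★
`K2LiuHermTwoXiEulerCalculus`, A4 `K2LiuHermTwoXiWeightedRankOneContinuation`).  DATA: `g > 0`, `h` (any complex `2 × 2` matrix for §1, the rank-one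
index `hermTwo(t,0,0)` in §2), `Φ = ξ-int(g,h;α,β)` (character included), `p = re g₀₀ > 0`, `D(x) = (x₀₀ + ip)⁻¹`, and a weight `W` with Fréchet
derivative `W′` — `hWd : HasFDerivAt W (W′ x) x`, `hW'c : Continuous W′`, `‖W‖, ‖W′‖ ≤ B`.
* §1 `hasLineDerivAt_weighted` — `D_v(W·Φ·D) = (W′v)ΦD + W·(D_vΦ·D + Φ·(−v₁D²))` (product rule over ★ A2); `integrable_ibp_products` — on `{re(α+β) > 3}`
  the three products `G`, `ℓG`, `ℓ·D_vG` are integrable for a continuous coordinate `ℓ` with `‖ℓ‖ ≤ Cx|det(g+ix)|` (★ A1's majorant principle with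
  `m = 0, 1`); **`integral_coord_mul_lineDeriv_weighted`** — `∫ ℓ·D_v(WΦD) = −∫ WΦD` when `D_vℓ = 1` (★ `integral_mul_eq_neg_of_hasLineDerivAt`, i.e.
  Mathlib's `integral_bilinear_hasLineDerivAt_right_eq_neg_left_of_integrable`: NO decay hypotheses).
* §2 `hasLineDerivAt_coords` (the four Lebesgue coordinates `a, re z, im z, b` have unit derivative along `E_a, E_u, E_v, E_b`), `euler_weight`
  (`Σ x_i W′(x)E_i = W′(x)x`), **`euler_pointwise`**: with `h = hermTwo(t,0,0)`,
  `Σ_i x_i·D_{E_i}(WΦD) = −2πi t·WΦ + [ (W′x)D·Φ + (−2πtp − 2(α+β) − 1)·WD·Φ − α·tr(adj(g−ix)g)·WD·Φ_{α+1,β} − β·tr(adj(g+ix)g)·WD·Φ_{α,β+1} + ip·WD²·Φ ]`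
  (★ A2: radial decomposition `trace_mul_hermTwo_decomp`, homogeneity `trace_adjugate_{sub,add}_mul_chart`, phase `trace_rankOne_mul_hermTwo`, divisor
  `x₀₀D = 1 − ipD`; index shifts ★ `xiTwoIntegrand_succ_left∕right`; closed by `linear_combination` including `i² = −1`).
References: [Shimura1982, §1 (1.25), §3]; [Shimura1997, §16.4–16.5]; [FarautKoranyi1994, Ch. VII §1].
HONEST LABEL.  Count-neutral helper; closes no socket: HC_CM is proved only modulo the 7 printed citations (2 remaining named inputs:
hLiu418 = `stmt-HodgeConjecture-24832`, h413 = `stmt-HodgeConjecture-24833`) until rung 0 closes.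
-/

set_option autoImplicit false
-- the mandated namespace repeats the single-problem summit's segment (`HodgeConjecture.HodgeConjecture`)
set_option linter.dupNamespace false

noncomputable section

open Complex MeasureTheory Set Metric
open scoped ComplexOrder ComplexConjugate

namespace Summit.HodgeConjecture.HodgeConjecture.Cruxes.HLiu418.K2LiuHermTwoXiWeightedEulerIdentity

open Summit.HodgeConjecture.HodgeConjecture.Cruxes.HLiu418.K2LiuHermTwoGammaDefs
open Summit.HodgeConjecture.HodgeConjecture.Cruxes.HLiu418.K2LiuHermTwoDetPowerIntegrable
open Summit.HodgeConjecture.HodgeConjecture.Cruxes.HLiu418.K2LiuHermTwoConfluentXiDefs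
open Summit.HodgeConjecture.HodgeConjecture.Cruxes.HLiu418.K2LiuHermTwoConfluentXiConvergence
open Summit.HodgeConjecture.HodgeConjecture.Cruxes.HLiu418.K2LiuHermTwoConfluentXiRegularity
open Summit.HodgeConjecture.HodgeConjecture.Cruxes.HLiu418.K2LiuHermTwoEtaDefs
open Summit.HodgeConjecture.HodgeConjecture.Cruxes.HLiu418.K2LiuHermTwoXiIntegrandLineDeriv
open Summit.HodgeConjecture.HodgeConjecture.Cruxes.HLiu418.K2LiuHermTwoXiIntegrandCayley
open Summit.HodgeConjecture.HodgeConjecture.Cruxes.HLiu418.K2LiuHermTwoXiCayleyIntegrability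
open Summit.HodgeConjecture.HodgeConjecture.Cruxes.HLiu418.K2LiuHermTwoXiCayleyRecursion
open Summit.HodgeConjecture.HodgeConjecture.Cruxes.HLiu418.K2LiuHermTwoXiGainKernel
open Summit.HodgeConjecture.HodgeConjecture.Cruxes.HLiu418.K2LiuHermTwoXiEulerCalculus

/-! ## §1 One coordinate integration by parts of the weighted integrand `G = W·Φ·D` -/

/-- `re g₀₀ > 0` for `g > 0`. [folklore] -/
theorem re_apply_zero_zero_pos {g : Matrix (Fin 2) (Fin 2) ℂ} (hg : g.PosDef) : 0 < (g 0 0).re := by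
  have hg' : hermTwo ((g 0 0).re, g 0 1, (g 1 1).re) = g := hermTwo_eq_of_isHermitian hg.1
  exact ((posDef_hermTwo_iff ((g 0 0).re, g 0 1, (g 1 1).re)).mp (hg'.symm ▸ hg)).1

section IBP

variable {g h : Matrix (Fin 2) (Fin 2) ℂ} {α β : ℂ} {W : ℝ × ℂ × ℝ → ℂ} {W' : ℝ × ℂ × ℝ → (ℝ × ℂ × ℝ →L[ℝ] ℂ)} {B : ℝ}

/-- **THE WEIGHTED INTEGRAND `G = W·Φ·D` HAS A LINE DERIVATIVE IN EVERY DIRECTION** (product rule: the weight's Fréchet derivative, FILE A2's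
`hasLineDerivAt_xiTwoIntegrand` and `hasLineDerivAt_divisor`). [cite: Shimura1982, §3] -/
theorem hasLineDerivAt_weighted (hg : g.PosDef) (h : Matrix (Fin 2) (Fin 2) ℂ) (α β : ℂ) (hWd : ∀ c, HasFDerivAt W (W' c) c) (c v : ℝ × ℂ × ℝ) :
    HasLineDerivAt ℝ (fun c : ℝ × ℂ × ℝ => W c * (xiTwoIntegrand g h α β c * ((c.1 : ℂ) + I * ((g 0 0).re : ℂ))⁻¹))
      (W' c v * (xiTwoIntegrand g h α β c * ((c.1 : ℂ) + I * ((g 0 0).re : ℂ))⁻¹) +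
        W c * ((-(2 * Real.pi * I) * (h * hermTwo v).trace * xiTwoIntegrand g h α β c +
            (-(I * α) * (((g - I • hermTwo c).adjugate * hermTwo v).trace * xiTwoIntegrand g h (α + 1) β c) +
              I * β * (((g + I • hermTwo c).adjugate * hermTwo v).trace * xiTwoIntegrand g h α (β + 1) c))) * ((c.1 : ℂ) + I * ((g 0 0).re : ℂ))⁻¹ +
          xiTwoIntegrand g h α β c * (-(v.1 : ℂ) * (((c.1 : ℂ) + I * ((g 0 0).re : ℂ))⁻¹) ^ 2))) c v := by
  have hp := re_apply_zero_zero_pos hg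
  have h1 : HasDerivAt (fun τ : ℝ => W (c + τ • v)) (W' c v) 0 := (hWd c).hasLineDerivAt v
  have h2 : HasDerivAt (fun τ : ℝ => xiTwoIntegrand g h α β (c + τ • v))
      (-(2 * Real.pi * I) * (h * hermTwo v).trace * xiTwoIntegrand g h α β c +
        (-(I * α) * (((g - I • hermTwo c).adjugate * hermTwo v).trace * xiTwoIntegrand g h (α + 1) β c) +
          I * β * (((g + I • hermTwo c).adjugate * hermTwo v).trace * xiTwoIntegrand g h α (β + 1) c))) 0 :=
    hasLineDerivAt_xiTwoIntegrand hg h α β c v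
  have h3 : HasDerivAt (fun τ : ℝ => (((c + τ • v).1 : ℂ) + I * ((g 0 0).re : ℂ))⁻¹)
      (-(v.1 : ℂ) * (((c.1 : ℂ) + I * ((g 0 0).re : ℂ))⁻¹) ^ 2) 0 := hasLineDerivAt_divisor hp c v
  have h4 := h1.mul (h2.mul h3)
  show HasDerivAt (fun τ : ℝ => W (c + τ • v) * (xiTwoIntegrand g h α β (c + τ • v) * ((((c + τ • v).1 : ℂ) + I * ((g 0 0).re : ℂ))⁻¹))) _ 0
  refine h4.congr_deriv ?_
  simp only [Pi.mul_apply, zero_smul, add_zero]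

/-- **INTEGRABILITY OF THE THREE INTEGRATION-BY-PARTS PRODUCTS** on the half-space of absolute convergence (`re(α+β) > 3`): `G`, `ℓ·G` and `ℓ·D_vG`
for a continuous coordinate function `ℓ` dominated by `Cx·|det(g + ix)|` (every factor is bounded relative to `‖Φ‖`, `|det|·‖Φ‖` or `(x₀₀²+p²)^{−1/2}`;
majorant principle of FILE A1 with `m = 0, 1`). [cite: Shimura1982, §3] -/
theorem integrable_ibp_products (hg : g.PosDef) (hh : h.IsHermitian) (hσ : 3 < (α + β).re)
    (hWd : ∀ c, HasFDerivAt W (W' c) c) (hW'c : Continuous W') (hWb : ∀ c, ‖W c‖ ≤ B) (hW'b : ∀ c, ‖W' c‖ ≤ B)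
    {ℓ : ℝ × ℂ × ℝ → ℂ} (hℓc : Continuous ℓ) {Cx : ℝ} (hCx : 0 ≤ Cx) (hℓb : ∀ c, ‖ℓ c‖ ≤ Cx * ‖(g + I • hermTwo c).det‖) (v : ℝ × ℂ × ℝ) :
    Integrable (fun c : ℝ × ℂ × ℝ => W c * (xiTwoIntegrand g h α β c * ((c.1 : ℂ) + I * ((g 0 0).re : ℂ))⁻¹)) ∧
    Integrable (fun c : ℝ × ℂ × ℝ => ℓ c * (W c * (xiTwoIntegrand g h α β c * ((c.1 : ℂ) + I * ((g 0 0).re : ℂ))⁻¹))) ∧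
    Integrable (fun c : ℝ × ℂ × ℝ => ℓ c *
      (W' c v * (xiTwoIntegrand g h α β c * ((c.1 : ℂ) + I * ((g 0 0).re : ℂ))⁻¹) +
        W c * ((-(2 * Real.pi * I) * (h * hermTwo v).trace * xiTwoIntegrand g h α β c +
            (-(I * α) * (((g - I • hermTwo c).adjugate * hermTwo v).trace * xiTwoIntegrand g h (α + 1) β c) +
              I * β * (((g + I • hermTwo c).adjugate * hermTwo v).trace * xiTwoIntegrand g h α (β + 1) c))) * ((c.1 : ℂ) + I * ((g 0 0).re : ℂ))⁻¹ +
          xiTwoIntegrand g h α β c * (-(v.1 : ℂ) * (((c.1 : ℂ) + I * ((g 0 0).re : ℂ))⁻¹) ^ 2)))) := by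
  have hp := re_apply_zero_zero_pos hg
  have hB : 0 ≤ B := (norm_nonneg _).trans (hWb 0)
  obtain ⟨CΦ, hCΦ, hΦ'⟩ := exists_norm_lineDeriv_xiTwoIntegrand_le hg h α β v
  -- names for the pieces
  set D : ℝ × ℂ × ℝ → ℂ := fun c => ((c.1 : ℂ) + I * ((g 0 0).re : ℂ))⁻¹ with hD
  set Φ : ℝ × ℂ × ℝ → ℂ := xiTwoIntegrand g h α β with hΦ
  set Φ' : ℝ × ℂ × ℝ → ℂ := fun c => -(2 * Real.pi * I) * (h * hermTwo v).trace * xiTwoIntegrand g h α β c +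
      (-(I * α) * (((g - I • hermTwo c).adjugate * hermTwo v).trace * xiTwoIntegrand g h (α + 1) β c) +
        I * β * (((g + I • hermTwo c).adjugate * hermTwo v).trace * xiTwoIntegrand g h α (β + 1) c)) with hΦ'def
  -- measurability
  have hWc : Continuous W := continuous_iff_continuousAt.mpr fun c => (hWd c).continuousAt
  have hW'vc : Continuous fun c => W' c v := hW'c.clm_apply continuous_const
  have hDc : Continuous D := by
    refine Continuous.inv₀ (by fun_prop) fun c => coord_add_I_mul_ne_zero c.1 hp
  have hΦm : AEStronglyMeasurable Φ (volume : Measure (ℝ × ℂ × ℝ)) := aestronglyMeasurable_xiTwoIntegrand g h α β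
  have hΦ'm : AEStronglyMeasurable Φ' (volume : Measure (ℝ × ℂ × ℝ)) := by
    refine ((Continuous.aestronglyMeasurable continuous_const).mul (aestronglyMeasurable_xiTwoIntegrand g h α β)).add
      ((((Continuous.aestronglyMeasurable continuous_const).mul
        ((continuous_trace_adjugate_sub_mul g (hermTwo v)).aestronglyMeasurable.mul (aestronglyMeasurable_xiTwoIntegrand g h (α + 1) β))).add
        ((Continuous.aestronglyMeasurable continuous_const).mul
          ((continuous_trace_adjugate_add_mul g (hermTwo v)).aestronglyMeasurable.mul (aestronglyMeasurable_xiTwoIntegrand g h α (β + 1))))))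
  have hGm : AEStronglyMeasurable (fun c => W c * (Φ c * D c)) (volume : Measure (ℝ × ℂ × ℝ)) :=
    hWc.aestronglyMeasurable.mul (hΦm.mul hDc.aestronglyMeasurable)
  -- pointwise sizes
  have hDn : ∀ c : ℝ × ℂ × ℝ, ‖D c‖ = (c.1 ^ 2 + (g 0 0).re ^ 2) ^ (-(1 / 2 : ℝ)) := fun c => norm_divisor c.1 hp
  have hDle : ∀ c : ℝ × ℂ × ℝ, ‖D c‖ ≤ ((g 0 0).re)⁻¹ := fun c => norm_divisor_le c.1 hp
  have hdet0 : ∀ c : ℝ × ℂ × ℝ, ‖(g + I • hermTwo c).det‖ ^ (0 : ℝ) = 1 := fun c => Real.rpow_zero _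
  have hdet1 : ∀ c : ℝ × ℂ × ℝ, ‖(g + I • hermTwo c).det‖ ^ (1 : ℝ) = ‖(g + I • hermTwo c).det‖ := fun c => Real.rpow_one _
  have hG : ∀ c, ‖W c * (Φ c * D c)‖ ≤ B * (‖(g + I • hermTwo c).det‖ ^ (0 : ℝ) * (c.1 ^ 2 + (g 0 0).re ^ 2) ^ (-(1 / 2 : ℝ))) * ‖Φ c‖ := by
    intro c
    rw [norm_mul, norm_mul, hdet0, one_mul, ← hDn c]
    calc ‖W c‖ * (‖Φ c‖ * ‖D c‖) ≤ B * (‖Φ c‖ * ‖D c‖) := mul_le_mul_of_nonneg_right (hWb c) (by positivity)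
      _ = B * ‖D c‖ * ‖Φ c‖ := by ring
  have hσ0 : 2 + (0 : ℝ) < (α + β).re := by linarith
  have hσ1 : 2 + (1 : ℝ) < (α + β).re := by linarith
  refine ⟨integrable_of_norm_le_gain hg hh hB hσ0 hGm hG, ?_, ?_⟩
  · refine integrable_of_norm_le_gain hg hh (mul_nonneg hCx hB) hσ1 (hℓc.aestronglyMeasurable.mul hGm) fun c => ?_
    rw [norm_mul, hdet1]
    calc ‖ℓ c‖ * ‖W c * (Φ c * D c)‖
        ≤ (Cx * ‖(g + I • hermTwo c).det‖) * (B * (‖(g + I • hermTwo c).det‖ ^ (0 : ℝ) * (c.1 ^ 2 + (g 0 0).re ^ 2) ^ (-(1 / 2 : ℝ))) * ‖Φ c‖) :=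
          mul_le_mul (hℓb c) (hG c) (norm_nonneg _) (by positivity)
      _ = Cx * B * (‖(g + I • hermTwo c).det‖ * (c.1 ^ 2 + (g 0 0).re ^ 2) ^ (-(1 / 2 : ℝ))) * ‖Φ c‖ := by rw [hdet0]; ring
  · have hm : AEStronglyMeasurable (fun c => ℓ c * (W' c v * (Φ c * D c) + W c * (Φ' c * D c + Φ c * (-(v.1 : ℂ) * D c ^ 2))))
        (volume : Measure (ℝ × ℂ × ℝ)) :=
      hℓc.aestronglyMeasurable.mul ((hW'vc.aestronglyMeasurable.mul (hΦm.mul hDc.aestronglyMeasurable)).add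
        (hWc.aestronglyMeasurable.mul ((hΦ'm.mul hDc.aestronglyMeasurable).add
          (hΦm.mul ((Continuous.aestronglyMeasurable continuous_const).mul (hDc.aestronglyMeasurable.pow 2))))))
    refine integrable_of_norm_le_gain hg hh (K := Cx * (B * (‖v‖ + CΦ + ‖v‖ * ((g 0 0).re)⁻¹))) (by positivity) hσ1 hm fun c => ?_
    have hv1 : ‖(v.1 : ℂ)‖ ≤ ‖v‖ := by rw [Complex.norm_real]; exact norm_fst_le v
    have hW'v : ‖W' c v‖ ≤ B * ‖v‖ := (ContinuousLinearMap.le_opNorm _ _).trans (mul_le_mul_of_nonneg_right (hW'b c) (norm_nonneg _))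
    have hDsq : ‖D c‖ ^ 2 ≤ ‖D c‖ * ((g 0 0).re)⁻¹ := by rw [sq]; exact mul_le_mul_of_nonneg_left (hDle c) (norm_nonneg _)
    set nD : ℝ := ‖(g + I • hermTwo c).det‖
    set Gn : ℝ := (c.1 ^ 2 + (g 0 0).re ^ 2) ^ (-(1 / 2 : ℝ))
    have hGn : ‖D c‖ = Gn := hDn c
    rw [hdet1]
    -- the three terms of `D_v G`
    have t1 : ‖W' c v * (Φ c * D c)‖ ≤ B * ‖v‖ * (‖Φ c‖ * Gn) := by
      rw [norm_mul, norm_mul, hGn]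
      exact mul_le_mul_of_nonneg_right hW'v (by rw [← hGn]; positivity)
    have t2 : ‖Φ' c * D c‖ ≤ CΦ * (‖Φ c‖ * Gn) := by
      rw [norm_mul, hGn, ← mul_assoc]
      exact mul_le_mul_of_nonneg_right (hΦ' c) (by rw [← hGn]; positivity)
    have t3 : ‖Φ c * (-(v.1 : ℂ) * D c ^ 2)‖ ≤ ‖v‖ * ((g 0 0).re)⁻¹ * (‖Φ c‖ * Gn) := by
      rw [norm_mul, norm_mul, norm_neg, norm_pow, ← hGn]
      calc ‖Φ c‖ * (‖(v.1 : ℂ)‖ * ‖D c‖ ^ 2) ≤ ‖Φ c‖ * (‖v‖ * (‖D c‖ * ((g 0 0).re)⁻¹)) :=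
            mul_le_mul_of_nonneg_left (mul_le_mul hv1 hDsq (by positivity) (norm_nonneg _)) (norm_nonneg _)
        _ = ‖v‖ * ((g 0 0).re)⁻¹ * (‖Φ c‖ * ‖D c‖) := by ring
    have t23 : ‖W c * (Φ' c * D c + Φ c * (-(v.1 : ℂ) * D c ^ 2))‖ ≤ B * ((CΦ + ‖v‖ * ((g 0 0).re)⁻¹) * (‖Φ c‖ * Gn)) := by
      rw [norm_mul]
      refine mul_le_mul (hWb c) ((norm_add_le _ _).trans ?_) (norm_nonneg _) hB
      calc ‖Φ' c * D c‖ + ‖Φ c * (-(v.1 : ℂ) * D c ^ 2)‖ ≤ CΦ * (‖Φ c‖ * Gn) + ‖v‖ * ((g 0 0).re)⁻¹ * (‖Φ c‖ * Gn) := add_le_add t2 t3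
        _ = (CΦ + ‖v‖ * ((g 0 0).re)⁻¹) * (‖Φ c‖ * Gn) := by ring
    have hsum : ‖W' c v * (Φ c * D c) + W c * (Φ' c * D c + Φ c * (-(v.1 : ℂ) * D c ^ 2))‖ ≤
        B * (‖v‖ + CΦ + ‖v‖ * ((g 0 0).re)⁻¹) * (‖Φ c‖ * Gn) := by
      refine (norm_add_le _ _).trans ?_
      calc ‖W' c v * (Φ c * D c)‖ + ‖W c * (Φ' c * D c + Φ c * (-(v.1 : ℂ) * D c ^ 2))‖
          ≤ B * ‖v‖ * (‖Φ c‖ * Gn) + B * ((CΦ + ‖v‖ * ((g 0 0).re)⁻¹) * (‖Φ c‖ * Gn)) := add_le_add t1 t23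
        _ = B * (‖v‖ + CΦ + ‖v‖ * ((g 0 0).re)⁻¹) * (‖Φ c‖ * Gn) := by ring
    rw [norm_mul]
    calc ‖ℓ c‖ * ‖W' c v * (Φ c * D c) + W c * (Φ' c * D c + Φ c * (-(v.1 : ℂ) * D c ^ 2))‖
        ≤ (Cx * nD) * (B * (‖v‖ + CΦ + ‖v‖ * ((g 0 0).re)⁻¹) * (‖Φ c‖ * Gn)) := mul_le_mul (hℓb c) hsum (norm_nonneg _) (by positivity)
      _ = Cx * (B * (‖v‖ + CΦ + ‖v‖ * ((g 0 0).re)⁻¹)) * (nD * Gn) * ‖Φ c‖ := by ring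

/-- **ONE COORDINATE INTEGRATION BY PARTS** (`re(α+β) > 3`): for a coordinate function `ℓ` with `D_v ℓ = 1` (continuous, dominated by `Cx·|det(g+ix)|`),
`∫ ℓ·D_v(W·Φ·D) = −∫ W·Φ·D` (★ `integral_mul_eq_neg_of_hasLineDerivAt`, no decay hypotheses — only the three integrabilities above). [cite: Shimura1982, §3] -/
theorem integral_coord_mul_lineDeriv_weighted (hg : g.PosDef) (hh : h.IsHermitian) (hσ : 3 < (α + β).re)
    (hWd : ∀ c, HasFDerivAt W (W' c) c) (hW'c : Continuous W') (hWb : ∀ c, ‖W c‖ ≤ B) (hW'b : ∀ c, ‖W' c‖ ≤ B)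
    {ℓ : ℝ × ℂ × ℝ → ℂ} {v : ℝ × ℂ × ℝ} (hℓd : ∀ c, HasLineDerivAt ℝ ℓ 1 c v) (hℓc : Continuous ℓ) {Cx : ℝ} (hCx : 0 ≤ Cx)
    (hℓb : ∀ c, ‖ℓ c‖ ≤ Cx * ‖(g + I • hermTwo c).det‖) :
    ∫ c : ℝ × ℂ × ℝ, ℓ c *
      (W' c v * (xiTwoIntegrand g h α β c * ((c.1 : ℂ) + I * ((g 0 0).re : ℂ))⁻¹) +
        W c * ((-(2 * Real.pi * I) * (h * hermTwo v).trace * xiTwoIntegrand g h α β c +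
            (-(I * α) * (((g - I • hermTwo c).adjugate * hermTwo v).trace * xiTwoIntegrand g h (α + 1) β c) +
              I * β * (((g + I • hermTwo c).adjugate * hermTwo v).trace * xiTwoIntegrand g h α (β + 1) c))) * ((c.1 : ℂ) + I * ((g 0 0).re : ℂ))⁻¹ +
          xiTwoIntegrand g h α β c * (-(v.1 : ℂ) * (((c.1 : ℂ) + I * ((g 0 0).re : ℂ))⁻¹) ^ 2))) =
      -∫ c : ℝ × ℂ × ℝ, W c * (xiTwoIntegrand g h α β c * ((c.1 : ℂ) + I * ((g 0 0).re : ℂ))⁻¹) := by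
  obtain ⟨hI, hℓI, hℓI'⟩ := integrable_ibp_products hg hh hσ hWd hW'c hWb hW'b hℓc hCx hℓb v
  have hibp := integral_mul_eq_neg_of_hasLineDerivAt (v := v) (f := ℓ) (f' := fun _ => (1 : ℂ))
    (g := fun c : ℝ × ℂ × ℝ => W c * (xiTwoIntegrand g h α β c * ((c.1 : ℂ) + I * ((g 0 0).re : ℂ))⁻¹))
    (g' := fun c : ℝ × ℂ × ℝ => W' c v * (xiTwoIntegrand g h α β c * ((c.1 : ℂ) + I * ((g 0 0).re : ℂ))⁻¹) +
        W c * ((-(2 * Real.pi * I) * (h * hermTwo v).trace * xiTwoIntegrand g h α β c +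
            (-(I * α) * (((g - I • hermTwo c).adjugate * hermTwo v).trace * xiTwoIntegrand g h (α + 1) β c) +
              I * β * (((g + I • hermTwo c).adjugate * hermTwo v).trace * xiTwoIntegrand g h α (β + 1) c))) * ((c.1 : ℂ) + I * ((g 0 0).re : ℂ))⁻¹ +
          xiTwoIntegrand g h α β c * (-(v.1 : ℂ) * (((c.1 : ℂ) + I * ((g 0 0).re : ℂ))⁻¹) ^ 2)))
    (by simpa only [one_mul] using hI) hℓI' hℓI hℓd (fun c => hasLineDerivAt_weighted hg h α β hWd c v)
  rw [hibp]
  simp only [one_mul]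

end IBP

/-! ## §2 The pointwise Euler identity

### §2.1 The four coordinate functions -/

/-- `(t : ℝ) ↦ (const + t : ℂ)` has derivative `1`. [folklore] -/
theorem hasDerivAt_ofReal_const_add (a : ℂ) : HasDerivAt (fun τ : ℝ => a + (τ : ℂ)) 1 0 := by
  have h0 : HasDerivAt (fun s : ℝ => (s : ℂ)) 1 0 := by simpa using (hasDerivAt_id (0 : ℝ)).ofReal_comp
  simpa using h0.const_add a

/-- **THE FOUR LEBESGUE COORDINATES HAVE UNIT LINE DERIVATIVE ALONG THEIR DIRECTIONS**: `D_{E_a} a = D_{E_u} re z = D_{E_v} im z = D_{E_b} b = 1`. [folklore] -/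
theorem hasLineDerivAt_coords (c : ℝ × ℂ × ℝ) :
    HasLineDerivAt ℝ (fun c : ℝ × ℂ × ℝ => (c.1 : ℂ)) 1 c ((1 : ℝ), (0 : ℂ), (0 : ℝ)) ∧
    HasLineDerivAt ℝ (fun c : ℝ × ℂ × ℝ => (c.2.1.re : ℂ)) 1 c ((0 : ℝ), (1 : ℂ), (0 : ℝ)) ∧
    HasLineDerivAt ℝ (fun c : ℝ × ℂ × ℝ => (c.2.1.im : ℂ)) 1 c ((0 : ℝ), I, (0 : ℝ)) ∧
    HasLineDerivAt ℝ (fun c : ℝ × ℂ × ℝ => (c.2.2 : ℂ)) 1 c ((0 : ℝ), (0 : ℂ), (1 : ℝ)) := by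
  refine ⟨?_, ?_, ?_, ?_⟩
  · show HasDerivAt (fun τ : ℝ => (((c + τ • ((1 : ℝ), (0 : ℂ), (0 : ℝ))).1 : ℝ) : ℂ)) 1 0
    have e : (fun τ : ℝ => (((c + τ • ((1 : ℝ), (0 : ℂ), (0 : ℝ))).1 : ℝ) : ℂ)) = fun τ : ℝ => (c.1 : ℂ) + (τ : ℂ) := by
      funext τ; simp
    rw [e]; exact hasDerivAt_ofReal_const_add _
  · show HasDerivAt (fun τ : ℝ => (((c + τ • ((0 : ℝ), (1 : ℂ), (0 : ℝ))).2.1.re : ℝ) : ℂ)) 1 0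
    have e : (fun τ : ℝ => (((c + τ • ((0 : ℝ), (1 : ℂ), (0 : ℝ))).2.1.re : ℝ) : ℂ)) = fun τ : ℝ => (c.2.1.re : ℂ) + (τ : ℂ) := by
      funext τ; simp
    rw [e]; exact hasDerivAt_ofReal_const_add _
  · show HasDerivAt (fun τ : ℝ => (((c + τ • ((0 : ℝ), I, (0 : ℝ))).2.1.im : ℝ) : ℂ)) 1 0
    have e : (fun τ : ℝ => (((c + τ • ((0 : ℝ), I, (0 : ℝ))).2.1.im : ℝ) : ℂ)) = fun τ : ℝ => (c.2.1.im : ℂ) + (τ : ℂ) := by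
      funext τ; simp
    rw [e]; exact hasDerivAt_ofReal_const_add _
  · show HasDerivAt (fun τ : ℝ => (((c + τ • ((0 : ℝ), (0 : ℂ), (1 : ℝ))).2.2 : ℝ) : ℂ)) 1 0
    have e : (fun τ : ℝ => (((c + τ • ((0 : ℝ), (0 : ℂ), (1 : ℝ))).2.2 : ℝ) : ℂ)) = fun τ : ℝ => (c.2.2 : ℂ) + (τ : ℂ) := by
      funext τ; simp
    rw [e]; exact hasDerivAt_ofReal_const_add _

/-! ### §2.2 The pointwise Euler identity for the weighted integrand -/

section Euler

variable {g : Matrix (Fin 2) (Fin 2) ℂ} {α β : ℂ} {W : ℝ × ℂ × ℝ → ℂ} {W' : ℝ × ℂ × ℝ → (ℝ × ℂ × ℝ →L[ℝ] ℂ)} {B : ℝ}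

/-- The weight's Euler derivative is the coordinate combination of its four directional derivatives (linearity of `W′(x)`). [folklore] -/
theorem euler_weight (W' : ℝ × ℂ × ℝ → (ℝ × ℂ × ℝ →L[ℝ] ℂ)) (c : ℝ × ℂ × ℝ) :
    (c.1 : ℂ) * W' c ((1 : ℝ), (0 : ℂ), (0 : ℝ)) + (c.2.1.re : ℂ) * W' c ((0 : ℝ), (1 : ℂ), (0 : ℝ)) +
        (c.2.1.im : ℂ) * W' c ((0 : ℝ), I, (0 : ℝ)) + (c.2.2 : ℂ) * W' c ((0 : ℝ), (0 : ℂ), (1 : ℝ)) = W' c c := by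
  rw [show W' c c = W' c (c.1 • ((1 : ℝ), (0 : ℂ), (0 : ℝ)) + c.2.1.re • ((0 : ℝ), (1 : ℂ), (0 : ℝ)) + c.2.1.im • ((0 : ℝ), I, (0 : ℝ)) +
      c.2.2 • ((0 : ℝ), (0 : ℂ), (1 : ℝ))) from congrArg (W' c) (coord_decomp c)]
  simp only [map_add, map_smul, Complex.real_smul]

/-- **THE POINTWISE EULER IDENTITY** (`g > 0`, `h = hermTwo(t,0,0)`, `p = re g₀₀`, `D = (x₀₀+ip)⁻¹`, `Φ = ξ-int(α,β)`):
`Σ_i x_i·D_{E_i}(W·Φ·D) = −2πi t·WΦ + [ (W′x)·D·Φ + (−2πtp − 2(α+β) − 1)·WD·Φ − α·tr(adj(g−ix)g)·WD·Φ_{α+1,β} − β·tr(adj(g+ix)g)·WD·Φ_{α,β+1} + ip·WD²·Φ ]`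
(radial field by `trace_mul_hermTwo_decomp`, homogeneity of `det` by `trace_adjugate_{sub,add}_mul_chart`, index shifts ★ `xiTwoIntegrand_succ_left∕right`,
`x₀₀D = 1 − ipD`). [cite: Shimura1982, §3] [cite: FarautKoranyi1994, Ch. VII §1] -/
theorem euler_pointwise (hg : g.PosDef) (t : ℝ) (α β : ℂ) (W : ℝ × ℂ × ℝ → ℂ) (W' : ℝ × ℂ × ℝ → (ℝ × ℂ × ℝ →L[ℝ] ℂ)) (c : ℝ × ℂ × ℝ) :
    (c.1 : ℂ) * (W' c ((1 : ℝ), (0 : ℂ), (0 : ℝ)) * (xiTwoIntegrand g (hermTwo (t, 0, 0)) α β c * ((c.1 : ℂ) + I * ((g 0 0).re : ℂ))⁻¹) +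
        W c * ((-(2 * Real.pi * I) * (hermTwo (t, 0, 0) * hermTwo ((1 : ℝ), (0 : ℂ), (0 : ℝ))).trace * xiTwoIntegrand g (hermTwo (t, 0, 0)) α β c +
            (-(I * α) * (((g - I • hermTwo c).adjugate * hermTwo ((1 : ℝ), (0 : ℂ), (0 : ℝ))).trace * xiTwoIntegrand g (hermTwo (t, 0, 0)) (α + 1) β c) +
              I * β * (((g + I • hermTwo c).adjugate * hermTwo ((1 : ℝ), (0 : ℂ), (0 : ℝ))).trace * xiTwoIntegrand g (hermTwo (t, 0, 0)) α (β + 1) c))) *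
              ((c.1 : ℂ) + I * ((g 0 0).re : ℂ))⁻¹ +
          xiTwoIntegrand g (hermTwo (t, 0, 0)) α β c * (-((((1 : ℝ), (0 : ℂ), (0 : ℝ)) : ℝ × ℂ × ℝ).1 : ℂ) * (((c.1 : ℂ) + I * ((g 0 0).re : ℂ))⁻¹) ^ 2))) +
    (c.2.1.re : ℂ) * (W' c ((0 : ℝ), (1 : ℂ), (0 : ℝ)) * (xiTwoIntegrand g (hermTwo (t, 0, 0)) α β c * ((c.1 : ℂ) + I * ((g 0 0).re : ℂ))⁻¹) +
        W c * ((-(2 * Real.pi * I) * (hermTwo (t, 0, 0) * hermTwo ((0 : ℝ), (1 : ℂ), (0 : ℝ))).trace * xiTwoIntegrand g (hermTwo (t, 0, 0)) α β c +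
            (-(I * α) * (((g - I • hermTwo c).adjugate * hermTwo ((0 : ℝ), (1 : ℂ), (0 : ℝ))).trace * xiTwoIntegrand g (hermTwo (t, 0, 0)) (α + 1) β c) +
              I * β * (((g + I • hermTwo c).adjugate * hermTwo ((0 : ℝ), (1 : ℂ), (0 : ℝ))).trace * xiTwoIntegrand g (hermTwo (t, 0, 0)) α (β + 1) c))) *
              ((c.1 : ℂ) + I * ((g 0 0).re : ℂ))⁻¹ +
          xiTwoIntegrand g (hermTwo (t, 0, 0)) α β c * (-((((0 : ℝ), (1 : ℂ), (0 : ℝ)) : ℝ × ℂ × ℝ).1 : ℂ) * (((c.1 : ℂ) + I * ((g 0 0).re : ℂ))⁻¹) ^ 2))) +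
    (c.2.1.im : ℂ) * (W' c ((0 : ℝ), I, (0 : ℝ)) * (xiTwoIntegrand g (hermTwo (t, 0, 0)) α β c * ((c.1 : ℂ) + I * ((g 0 0).re : ℂ))⁻¹) +
        W c * ((-(2 * Real.pi * I) * (hermTwo (t, 0, 0) * hermTwo ((0 : ℝ), I, (0 : ℝ))).trace * xiTwoIntegrand g (hermTwo (t, 0, 0)) α β c +
            (-(I * α) * (((g - I • hermTwo c).adjugate * hermTwo ((0 : ℝ), I, (0 : ℝ))).trace * xiTwoIntegrand g (hermTwo (t, 0, 0)) (α + 1) β c) +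
              I * β * (((g + I • hermTwo c).adjugate * hermTwo ((0 : ℝ), I, (0 : ℝ))).trace * xiTwoIntegrand g (hermTwo (t, 0, 0)) α (β + 1) c))) *
              ((c.1 : ℂ) + I * ((g 0 0).re : ℂ))⁻¹ +
          xiTwoIntegrand g (hermTwo (t, 0, 0)) α β c * (-((((0 : ℝ), I, (0 : ℝ)) : ℝ × ℂ × ℝ).1 : ℂ) * (((c.1 : ℂ) + I * ((g 0 0).re : ℂ))⁻¹) ^ 2))) +
    (c.2.2 : ℂ) * (W' c ((0 : ℝ), (0 : ℂ), (1 : ℝ)) * (xiTwoIntegrand g (hermTwo (t, 0, 0)) α β c * ((c.1 : ℂ) + I * ((g 0 0).re : ℂ))⁻¹) +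
        W c * ((-(2 * Real.pi * I) * (hermTwo (t, 0, 0) * hermTwo ((0 : ℝ), (0 : ℂ), (1 : ℝ))).trace * xiTwoIntegrand g (hermTwo (t, 0, 0)) α β c +
            (-(I * α) * (((g - I • hermTwo c).adjugate * hermTwo ((0 : ℝ), (0 : ℂ), (1 : ℝ))).trace * xiTwoIntegrand g (hermTwo (t, 0, 0)) (α + 1) β c) +
              I * β * (((g + I • hermTwo c).adjugate * hermTwo ((0 : ℝ), (0 : ℂ), (1 : ℝ))).trace * xiTwoIntegrand g (hermTwo (t, 0, 0)) α (β + 1) c))) *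
              ((c.1 : ℂ) + I * ((g 0 0).re : ℂ))⁻¹ +
          xiTwoIntegrand g (hermTwo (t, 0, 0)) α β c * (-((((0 : ℝ), (0 : ℂ), (1 : ℝ)) : ℝ × ℂ × ℝ).1 : ℂ) * (((c.1 : ℂ) + I * ((g 0 0).re : ℂ))⁻¹) ^ 2))) =
    -(2 * Real.pi * I * t) * (W c * xiTwoIntegrand g (hermTwo (t, 0, 0)) α β c) +
      ((W' c c * ((c.1 : ℂ) + I * ((g 0 0).re : ℂ))⁻¹) * xiTwoIntegrand g (hermTwo (t, 0, 0)) α β c +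
        (-(2 * Real.pi * t * (g 0 0).re) - 2 * (α + β) - 1) * ((W c * ((c.1 : ℂ) + I * ((g 0 0).re : ℂ))⁻¹) * xiTwoIntegrand g (hermTwo (t, 0, 0)) α β c) -
        α * ((((g - I • hermTwo c).adjugate * g).trace * (W c * ((c.1 : ℂ) + I * ((g 0 0).re : ℂ))⁻¹)) * xiTwoIntegrand g (hermTwo (t, 0, 0)) (α + 1) β c) -
        β * ((((g + I • hermTwo c).adjugate * g).trace * (W c * ((c.1 : ℂ) + I * ((g 0 0).re : ℂ))⁻¹)) * xiTwoIntegrand g (hermTwo (t, 0, 0)) α (β + 1) c) +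
        I * ((g 0 0).re : ℂ) * ((W c * (((c.1 : ℂ) + I * ((g 0 0).re : ℂ))⁻¹) ^ 2) * xiTwoIntegrand g (hermTwo (t, 0, 0)) α β c)) := by
  have hp := re_apply_zero_zero_pos hg
  -- atoms
  set Dc : ℂ := ((c.1 : ℂ) + I * ((g 0 0).re : ℂ))⁻¹ with hDc
  set Φ0 : ℂ := xiTwoIntegrand g (hermTwo (t, 0, 0)) α β c with hΦ0
  set Φa : ℂ := xiTwoIntegrand g (hermTwo (t, 0, 0)) (α + 1) β c with hΦa
  set Φb : ℂ := xiTwoIntegrand g (hermTwo (t, 0, 0)) α (β + 1) c with hΦb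
  -- (i) the radial field: collect the four directions
  have hW := euler_weight W' c
  have hτ := trace_mul_hermTwo_decomp (hermTwo (t, 0, 0)) c
  have hy := trace_mul_hermTwo_decomp (g - I • hermTwo c).adjugate c
  have hw := trace_mul_hermTwo_decomp (g + I • hermTwo c).adjugate c
  -- (ii) homogeneity, the phase, the index shifts, the divisor
  have hph := trace_rankOne_mul_hermTwo t c
  have hhy := trace_adjugate_sub_mul_chart g c
  have hhw := trace_adjugate_add_mul_chart g c
  have hPne : (g - I • hermTwo c).det ≠ 0 := det_sub_I_smul_hermTwo_ne_zero hg c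
  have hQne : (g + I • hermTwo c).det ≠ 0 := det_add_I_smul_hermTwo_ne_zero hg c
  have hsa : (g - I • hermTwo c).det * Φa = -Φ0 := by
    rw [hΦa, xiTwoIntegrand_succ_left hg, ← hΦ0]
    field_simp
  have hsb : (g + I • hermTwo c).det * Φb = -Φ0 := by
    rw [hΦb, xiTwoIntegrand_succ_right hg, ← hΦ0]
    field_simp
  have hD := (coord_mul_divisor c.1 hp).1
  rw [← hDc] at hD
  -- stage A: everything is the coordinate combination
  have stageA : (c.1 : ℂ) * (W' c ((1 : ℝ), (0 : ℂ), (0 : ℝ)) * (Φ0 * Dc) +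
        W c * ((-(2 * Real.pi * I) * (hermTwo (t, 0, 0) * hermTwo ((1 : ℝ), (0 : ℂ), (0 : ℝ))).trace * Φ0 +
            (-(I * α) * (((g - I • hermTwo c).adjugate * hermTwo ((1 : ℝ), (0 : ℂ), (0 : ℝ))).trace * Φa) +
              I * β * (((g + I • hermTwo c).adjugate * hermTwo ((1 : ℝ), (0 : ℂ), (0 : ℝ))).trace * Φb))) * Dc +
          Φ0 * (-((((1 : ℝ), (0 : ℂ), (0 : ℝ)) : ℝ × ℂ × ℝ).1 : ℂ) * Dc ^ 2))) +
      (c.2.1.re : ℂ) * (W' c ((0 : ℝ), (1 : ℂ), (0 : ℝ)) * (Φ0 * Dc) +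
        W c * ((-(2 * Real.pi * I) * (hermTwo (t, 0, 0) * hermTwo ((0 : ℝ), (1 : ℂ), (0 : ℝ))).trace * Φ0 +
            (-(I * α) * (((g - I • hermTwo c).adjugate * hermTwo ((0 : ℝ), (1 : ℂ), (0 : ℝ))).trace * Φa) +
              I * β * (((g + I • hermTwo c).adjugate * hermTwo ((0 : ℝ), (1 : ℂ), (0 : ℝ))).trace * Φb))) * Dc +
          Φ0 * (-((((0 : ℝ), (1 : ℂ), (0 : ℝ)) : ℝ × ℂ × ℝ).1 : ℂ) * Dc ^ 2))) +
      (c.2.1.im : ℂ) * (W' c ((0 : ℝ), I, (0 : ℝ)) * (Φ0 * Dc) +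
        W c * ((-(2 * Real.pi * I) * (hermTwo (t, 0, 0) * hermTwo ((0 : ℝ), I, (0 : ℝ))).trace * Φ0 +
            (-(I * α) * (((g - I • hermTwo c).adjugate * hermTwo ((0 : ℝ), I, (0 : ℝ))).trace * Φa) +
              I * β * (((g + I • hermTwo c).adjugate * hermTwo ((0 : ℝ), I, (0 : ℝ))).trace * Φb))) * Dc +
          Φ0 * (-((((0 : ℝ), I, (0 : ℝ)) : ℝ × ℂ × ℝ).1 : ℂ) * Dc ^ 2))) +
      (c.2.2 : ℂ) * (W' c ((0 : ℝ), (0 : ℂ), (1 : ℝ)) * (Φ0 * Dc) +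
        W c * ((-(2 * Real.pi * I) * (hermTwo (t, 0, 0) * hermTwo ((0 : ℝ), (0 : ℂ), (1 : ℝ))).trace * Φ0 +
            (-(I * α) * (((g - I • hermTwo c).adjugate * hermTwo ((0 : ℝ), (0 : ℂ), (1 : ℝ))).trace * Φa) +
              I * β * (((g + I • hermTwo c).adjugate * hermTwo ((0 : ℝ), (0 : ℂ), (1 : ℝ))).trace * Φb))) * Dc +
          Φ0 * (-((((0 : ℝ), (0 : ℂ), (1 : ℝ)) : ℝ × ℂ × ℝ).1 : ℂ) * Dc ^ 2))) =
      W' c c * (Φ0 * Dc) +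
        W c * ((-(2 * Real.pi * I) * (hermTwo (t, 0, 0) * hermTwo c).trace * Φ0 +
            (-(I * α) * (((g - I • hermTwo c).adjugate * hermTwo c).trace * Φa) + I * β * (((g + I • hermTwo c).adjugate * hermTwo c).trace * Φb))) * Dc +
          Φ0 * (-(c.1 : ℂ) * Dc ^ 2)) := by
    rw [← hW, hτ, hy, hw]
    push_cast
    ring
  rw [stageA, hph, hhy, hhw]
  linear_combination (2 * α * W c * Dc) * hsa + (2 * β * W c * Dc) * hsb +
    (-(2 * Real.pi * I * t) * W c * Φ0 - W c * Φ0 * Dc) * hD +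
    ((α * ((g - I • hermTwo c).adjugate * g).trace * Φa + β * ((g + I • hermTwo c).adjugate * g).trace * Φb -
      2 * α * (g - I • hermTwo c).det * Φa - 2 * β * (g + I • hermTwo c).det * Φb + 2 * Real.pi * t * (g 0 0).re * Φ0) * W c * Dc) * Complex.I_sq

end Euler

end Summit.HodgeConjecture.HodgeConjecture.Cruxes.HLiu418.K2LiuHermTwoXiWeightedEulerIdentity

end
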